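import Mathlib
import Summits.Ventures.PercRepro2.LocPairing
import Summits.Ventures.PercRepro2.LocUDom2
import Summits.Ventures.PercRepro2.SwRow
import Summits.Ventures.PercRepro2.SwPair

/-!
# g0's pairing (PAIR-𝓤) gives the pairing form of (SW)
(blind cell PercRepro2, night-4 g3, 2026-08-24T08:4xZ)

`PairU ends l h {S ∣ o ∈ S}` (LocPairing.lean, g0): an involution `τ` of `M₀ = srcU` with
`PairRel` — partners agree only on edges touching both blue clusters of `l`.  Conjugating by the
colour swap, `τ' = blue ∘ τ ∘ blue` is an involution of `Q = tgtU`; since `blue ∘ τ` is `C_B(l)`-local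
(`locSym_of_pairU`), it only enlarges the blue cluster of `h` (`cluster_blue_subset_of_localAtSet_blue`),
which is the red cluster of `h` of the swapped configuration.  Hence `swPair_of_pairU`:
`PairU ⟹ SwPair` — the hierarchy of pairing statements on the weight-free base is
`PairU (g0) ⟹ SwPair ⟹ Sw ⟺ 2′DOM`.
-/

namespace Summit.Ventures.PercRepro2

namespace LocRows

open Hull

variable {V : Type*} {E : Type*} [Fintype E] [DecidableEq E]

open scoped Classical

variable (ends : E → Sym2 V)

/-- **(PAIR-𝓤) at the principal up-set gives the pairing form of (SW).** -/
theorem swPair_of_pairU (l h o : V) (hp : PairU ends l h {S : Set V | o ∈ S}) :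
    SwPair ends l h o := by
  obtain ⟨τ, hτ, hrel⟩ := hp
  -- the conjugated involution on configurations
  let τ' : Config E → Config E := fun ζ =>
    if hζ : blue ζ ∈ srcU ends l h {S : Set V | o ∈ S} then blue (τ ⟨blue ζ, hζ⟩).1 else ζ
  have hτ' : ∀ ζ (hζ : ζ ∈ tgtU ends l h {S : Set V | o ∈ S}),
      τ' ζ = blue (τ ⟨blue ζ, (blue_mem_srcU_iff ends).2 hζ⟩).1 := by
    intro ζ hζ
    simp [τ', (blue_mem_srcU_iff ends).2 hζ]
  -- locality of `blue ∘ τ` at the blue cluster of the source (from `PairRel`)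
  have hloc : ∀ x : {ζ // ζ ∈ srcU ends l h {S : Set V | o ∈ S}},
      LocalAtSet ends (fun ζ => cluster ends (blue ζ) l) x.1 (blue (τ x).1) := by
    intro x e he
    exact (hrel x e (ne_blue_iff.1 he)).1
  refine ⟨τ', ?_, ?_, ?_⟩
  · intro ζ hζ
    rw [hτ' ζ hζ]
    exact blue_mem_tgtU ends (τ ⟨blue ζ, (blue_mem_srcU_iff ends).2 hζ⟩).2
  · intro ζ hζ
    have h1 : τ' ζ ∈ tgtU ends l h {S : Set V | o ∈ S} := by
      rw [hτ' ζ hζ]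
      exact blue_mem_tgtU ends (τ ⟨blue ζ, (blue_mem_srcU_iff ends).2 hζ⟩).2
    rw [hτ' (τ' ζ) h1]
    have e1 : (⟨blue (τ' ζ), (blue_mem_srcU_iff ends).2 h1⟩ :
        {ζ // ζ ∈ srcU ends l h {S : Set V | o ∈ S}}) = τ ⟨blue ζ, (blue_mem_srcU_iff ends).2 hζ⟩ := by
      apply Subtype.ext
      simp only [hτ' ζ hζ, blue_blue]
    rw [e1, hτ _]
    simp [blue_blue]
  · intro ζ hζ
    have h1 : τ' ζ ∈ tgtU ends l h {S : Set V | o ∈ S} := by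
      rw [hτ' ζ hζ]
      exact blue_mem_tgtU ends (τ ⟨blue ζ, (blue_mem_srcU_iff ends).2 hζ⟩).2
    -- the key inclusion, for an arbitrary element of `Q`
    have key : ∀ ζ (hζ : ζ ∈ tgtU ends l h {S : Set V | o ∈ S}),
        cluster ends ζ h ⊆ cluster ends (blue (τ' ζ)) h := by
      intro ζ hζ
      rw [hτ' ζ hζ]
      set x : {ζ // ζ ∈ srcU ends l h {S : Set V | o ∈ S}} :=
        ⟨blue ζ, (blue_mem_srcU_iff ends).2 hζ⟩ with hx
      have hh : h ∉ hull ends x.1 l := by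
        have := ((Finset.mem_filter.1 hζ).2).1
        rw [hx]; simpa [hull_blue] using this
      have := cluster_blue_subset_of_localAtSet_blue ends hh (hloc x)
      simpa [hx, blue_blue] using this
    refine ⟨key ζ hζ, ?_⟩
    have h2 := key (τ' ζ) h1
    -- `τ' (τ' ζ) = ζ`
    have hinv : τ' (τ' ζ) = ζ := by
      rw [hτ' (τ' ζ) h1]
      have e1 : (⟨blue (τ' ζ), (blue_mem_srcU_iff ends).2 h1⟩ :
          {ζ // ζ ∈ srcU ends l h {S : Set V | o ∈ S}}) =
          τ ⟨blue ζ, (blue_mem_srcU_iff ends).2 hζ⟩ := by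
        apply Subtype.ext
        simp only [hτ' ζ hζ, blue_blue]
      rw [e1, hτ _]
      simp [blue_blue]
    rwa [hinv] at h2

end LocRows

end Summit.Ventures.PercRepro2
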